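import Literature.AlgebraicGeometry.HodgeTheory.UnitaryTwoOneTimesAbelianCommutantInvarianceSharp
import Literature.AlgebraicGeometry.HodgeTheory.HodgeCommutantAbelianOfProducts
import HarnessLib

/-!
# `B³(T × E³)`, `T` a `(2,1)`-threefold, `E` a CM elliptic curve: the STRUCTURE of the rational `(3,3)`-classes —
# «divisor classes + a rational `(3,3)`-class in `(H^{2,1}(T) ⊗ H^{1,2}(E³)) ⊕ (H^{1,2}(T) ⊗ H^{2,1}(E³))`»
# (Moonen–Zarhin 1999 Thm. 0.2 (1), §5 (5.3), (5.12); TABLE X row 21, codimension three, first half)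

Family `hodge`, layer `Literature/AlgebraicGeometry/HodgeTheory`. Written for the cell `pub-hodgeav-hg6` (LADDER-HodgeAV row 2,
TABLE X row 21 `g6.E3xY3.(2,1)`, census programme γ2, brick γ2-D(ii)-structure, eng-2 g6; honest framing of that cell: HC / HC_AV /
HC_CM NOT proved — THIS file is UNCONDITIONAL). Theorems only (no definition, no named fact, D-0026; nothing admitted).

## What is proved

* **`exists_decomp_codimThree_of_unitaryTwoOne_cmCurve_cube`** — for `T` (here `Y`) a complex abelian threefold with
  `dim_ℚ End⁰(T) = 2` and `φ ≫ φ = -d` (`d > 0`) of multiplicity `1` at `i√d` or at `-i√d` (so `End⁰(T) = k = ℚ(√-d)` acts on the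
  tangent space with multiplicities `(2,1)`), and `E` an elliptic curve with complex multiplication `χ ≫ χ = -d'` (`d' > 0`, ANY
  imaginary quadratic field `ℚ(χ)`), every rational class `c` of Hodge type `(3,3)` on the sixfold `T × ((E × E) × E)` splits as
  `c = c_B + c_W` with
  - `c_B` a `ℂ`-combination of products of divisor classes (`divisorClassesSpan _ _ 3`);
  - `c_W` RATIONAL, of Hodge type `(3,3)`, and a `ℂ`-combination of exterior products `pr_T^* u ⌣ pr_S^* v` (`S = (E × E) × E`)
    with `u ∈ H³(T)`, `v ∈ H³(S)` of Hodge types `((2,1), (1,2))` or `((1,2), (2,1))`.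
  This is the class-level content of Moonen–Zarhin's computation of the Hodge group of `T × E³` in codimension three: the
  invariants of `Hg(T × S) ⊇ (k ⊗ k-torus of T) × 1` in `∧⁶ H¹` are spanned by the `T`-kind-balanced monomials (products of
  Hodge classes of `T` and of `S`, both divisor-generated in dimension `3`) and by the monomials with one letter from each of the
  three `k`-eigen-pairs of `H¹(T)` of total `T`-kind weight `±1`, i.e. `T`-type `(2,1)` or `(1,2)` (the SHARPENED export of the
  one-slot invariance theorem, `AVSlots.exists_coeff_eq_zero_off_balanced_or_unitPair_of_prod_unitaryTwoOne_abelianCommutant`, fed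
  with the abelian Hodge-commutant of `E³`, `hSc_cmCurve_powSucc … 2`); the latter are exactly the Künneth component of `S`-degree
  `3` of `c` (balanced words have an even number of `T`-letters, hence even `S`-degree `≠ 3`), which is rational
  (`isRationalClass_kunneth_symm_apply`) and of type `(3,3)` by kind balance.
  NOT asserted here: that `c_W` lies in the span of products `a ⌣ b` of rational Hodge classes of lower codimension (the second
  half of TABLE X row 21 codimension three, which needs the `S`-side decomposition of `H³(E³; ℚ)`), nor that `c_W` is a Weil class,
  nor `D³ ≠ B³`.

## Sources

* [MoonenZarhin1999LowDim] B. J. J. Moonen, Yu. G. Zarhin, *Hodge classes on abelian varieties of low dimension*,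
  Math. Ann. 315 (1999) 711–733, Thm. 0.2 (1)–(4), §5 (5.3), (5.12) (arXiv v2 = Math. Ann. numbering: the case (e) Hodge-ring computation is (5.12); MZ99 has no item (2.8) — earlier tree copies wrote «(2.8)» for Thm. 0.2 (1)–(4) read in codimension two).
* [HatcherAT2002] A. Hatcher, *Algebraic Topology* (2002), §3.2 Prop. 3.10, Thm. 3.16 (Künneth formula).
* [VoisinHodgeI2002] C. Voisin, *Hodge Theory and Complex Algebraic Geometry I* (2002), §11.3.2 Thm. 11.38.
-/

noncomputable section

open scoped TensorProduct
open CategoryTheory Module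

namespace Literature.AlgebraicGeometry.HodgeTheory

open Literature.AlgebraicTopology.SingularHomology
open Literature.AlgebraicGeometry.Motives (IsSmoothProjective AbelianVariety bettiCohomology
  ofRatClassBaseChange ofRatClassBaseChange_tmul HodgeTensorFacts hodgeTensorFacts_holds ComplexPoints)
open Literature.Barriers.HodgeConjecture
open Literature.AlgebraicGeometry.Motives.HodgeStructure
open Literature.AlgebraicGeometry.ComplexMultiplication
open Literature.RepresentationTheory.GeneralLinear
open Literature.NumberTheory.DiophantineGeometry

/-! ### §1 Künneth degrees and kind counts (copies of the private lemmas of R41 §4 and of `NoTypeIVTimesCMProductSpan` §1) -/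

section KunnethDegree

variable {hA h dd : ℕ}

/-- The two elements of `Fin 2`. [folklore] -/
private theorem fin2_eq_zero_or_one_c3 (r : Fin 2) : r = 0 ∨ r = 1 := by
  fin_cases r <;> simp

/-- The two cardinalities of a left/right split add up to the number of positions. [folklore] -/
private theorem card_isLeft_add_card_not_isLeft_c3 {T P : Type*} (col : Fin dd → T ⊕ P) :
    Fintype.card {t // (col t).isLeft = true} + Fintype.card {t // ¬ (col t).isLeft = true} = dd := by
  classical
  rw [Fintype.card_subtype_compl, Nat.add_sub_cancel' (Fintype.card_subtype_le _), Fintype.card_fin]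

/-- A `T`-kind-balanced word has an EVEN number of `T`-positions. [folklore] -/
private theorem even_card_isLeft_of_balanced_c3 (P : Fin dd → Fin hA ⊕ Fin h) (η : Fin dd → Fin 2)
    (hbal : ∑ t, Sum.elim (fun _ : Fin hA => if η t = 0 then (1 : ℤ) else -1) (fun _ : Fin h => (0 : ℤ)) (P t) = 0) :
    Even (Fintype.card {t // (P t).isLeft = true}) := by
  classical
  set A0 := (Finset.univ.filter fun t => (P t).isLeft = true ∧ η t = 0).card with hA0
  set A1 := (Finset.univ.filter fun t => (P t).isLeft = true ∧ η t = 1).card with hA1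
  have hsum : ∑ t, Sum.elim (fun _ : Fin hA => if η t = 0 then (1 : ℤ) else -1) (fun _ : Fin h => (0 : ℤ)) (P t) =
      (A0 : ℤ) - (A1 : ℤ) := by
    rw [hA0, hA1, Finset.card_filter, Finset.card_filter, Nat.cast_sum, Nat.cast_sum, ← Finset.sum_sub_distrib]
    refine Finset.sum_congr rfl fun t _ => ?_
    rcases hP : P t with ℓ | e
    · rcases Fin.exists_fin_two.1 ⟨η t, rfl⟩ with h0 | h0 <;> simp [h0]
    · simp
  have hcard : Fintype.card {t // (P t).isLeft = true} = A0 + A1 := by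
    rw [Fintype.card_subtype, hA0, hA1,
      ← Finset.card_filter_add_card_filter_not (s := Finset.univ.filter fun t => (P t).isLeft = true)
        (fun t => η t = 0), Finset.filter_filter, Finset.filter_filter]
    congr 2
    refine Finset.filter_congr fun t _ => ?_
    rcases Fin.exists_fin_two.1 ⟨η t, rfl⟩ with h0 | h0 <;> simp [h0]
  rw [hsum] at hbal
  have hA01 : A0 = A1 := by omega
  exact ⟨A0, by rw [hcard, hA01]⟩

/-- The numbers of letters of the two kinds add up to the length. [folklore] -/
private theorem sum_kinds_add_c3 {L : Type*} {r : ℕ} (w : Fin r → L × Fin 2) :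
    (∑ t, if (w t).2 = 0 then 1 else 0 : ℕ) + (∑ t, if (w t).2 = 0 then 0 else 1 : ℕ) = r := by
  rw [← Finset.sum_add_distrib]
  have h2 : ∀ t : Fin r, ((if (w t).2 = 0 then 1 else 0) + (if (w t).2 = 0 then 0 else 1) : ℕ) = 1 :=
    fun t => by split_ifs <;> rfl
  simp only [h2, Finset.sum_const, Finset.card_univ, Fintype.card_fin, smul_eq_mul, mul_one]

/-- The difference of the two kind counts is the kind weight (`+1` for kind `0`, `-1` for kind `1`). [folklore] -/
private theorem kinds_sub_eq_weight_c3 {L : Type*} {r : ℕ} (w : Fin r → L × Fin 2) :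
    ((∑ t, if (w t).2 = 0 then 1 else 0 : ℕ) : ℤ) - ((∑ t, if (w t).2 = 0 then 0 else 1 : ℕ) : ℤ) =
      ∑ t, (if (w t).2 = 0 then (1 : ℤ) else -1) := by
  push_cast
  rw [← Finset.sum_sub_distrib]
  exact Finset.sum_congr rfl fun t _ => by split_ifs <;> norm_num

end KunnethDegree

/-! ### §2 The structure theorem -/

section CodimThree

open MonoidalCategory CartesianMonoidalCategory

variable {Y E : AbelianVariety ℂ}

set_option maxHeartbeats 1600000 in
open scoped Classical in
/-- **`B³(T × E³) ⊆ D³(T × E³) + (rational `(3,3)`-classes in `pr_T^* H^{2,1}(T) ⌣ pr_S^* H^{1,2}(S) ⊕ pr_T^* H^{1,2}(T) ⌣ pr_S^* H^{2,1}(S)`)`,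
`S = (E × E) × E` — Moonen–Zarhin's Thm. 0.2 (1) mechanism for the SIXFOLD `E³ × T` (TABLE X row 21), codimension three, the
STRUCTURE half, a THEOREM.** Let `T` (here `Y`) be a complex abelian threefold with `dim_ℚ End⁰(T) = 2`, `φ ≫ φ = -d` (`d > 0`) of
multiplicity `1` at `i√d` or at `-i√d`, and `E` an elliptic curve with complex multiplication `χ ≫ χ = -d'` (`d' > 0`). Then every
rational `(3,3)`-class `c` on `T × ((E × E) × E)` is `c = c_B + c_W` with `c_B` a `ℂ`-combination of products of divisor classes and
`c_W` rational, of type `(3,3)`, in the `ℂ`-span of the exterior products `pr_T^* u ⌣ pr_S^* v`, `(u, v)` of Hodge types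
`((2,1),(1,2))` or `((1,2),(2,1))`.  Proof: the sharpened one-slot invariance theorem for `T × S` (fed with `hSc_cmCurve_powSucc … 2`)
writes `c` as a combination of monomials in Hodge-adapted rational-basis letters whose words are `T`-kind balanced (`c_B`: products
of a type-`(l,l)` monomial on `T` and a pure-type monomial on `S`, hence — `c_B` being rational of type `(3,3)` as `c - c_W` — in the
span of products of rational Hodge classes of `T` and of `S`, divisor classes since `dim T = dim S = 3`) or have one letter per
`T`-pair with `T`-kind weight `±1` (`c_W`: `T`-degree `3 = S`-degree, `T`-type `(2,1)`/`(1,2)`, total type `(3,3)`); `c_W` is the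
Künneth component of `S`-degree `3` of `c` (balanced words have even `S`-degree), whose coefficients along rational bases of `H^•(S)`
are rational. [cite: MoonenZarhin1999LowDim, Thm. 0.2 (1) with cases (a), (e) and §5 (5.3), (5.12)]
[cite: MoonenZarhin1999LowDim, Thm. 0.2 (1)–(4)] [cite: HatcherAT2002, §3.2 Thm. 3.16] [cite: VoisinHodgeI2002, §11.3.2 Thm. 11.38] -/
theorem exists_decomp_codimThree_of_unitaryTwoOne_cmCurve_cube (hY3 : Y.dim = 3)
    (hY2 : Module.finrank ℚ Y.endAlgebra = 2) (φY : Y ⟶ Y) {d : ℕ} (hd : 0 < d) (hφY : φY ≫ φY = -(d • 𝟙 Y))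
    (hm1 : eigenMultiplicity Y φY (Complex.I * (Real.sqrt d : ℂ)) = 1 ∨
      eigenMultiplicity Y φY (-(Complex.I * (Real.sqrt d : ℂ))) = 1)
    (hE1 : E.dim = 1) (χ : E ⟶ E) {d' : ℕ} (hd' : 0 < d') (hχ : χ ≫ χ = -(d' • 𝟙 E))
    {c : complexBetti (Y.prod ((E.prod E).prod E)).X (2 * 3)} (hcQ : IsRationalClass c)
    (hc : IsOfHodgeType (Y.prod ((E.prod E).prod E)).dim (Y.prod ((E.prod E).prod E)).X (2 * 3) 3 3 c) :
    ∃ cB cW : complexBetti (Y.prod ((E.prod E).prod E)).X (2 * 3), c = cB + cW ∧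
      cB ∈ divisorClassesSpan (Y.prod ((E.prod E).prod E)).X (Y.prod ((E.prod E).prod E)).dim 3 ∧
      IsRationalClass cW ∧ IsOfHodgeType (Y.prod ((E.prod E).prod E)).dim (Y.prod ((E.prod E).prod E)).X (2 * 3) 3 3 cW ∧
      cW ∈ Submodule.span ℂ {z : complexBetti (Y.prod ((E.prod E).prod E)).X (2 * 3) |
        ∃ (u : complexBetti Y.X 3) (v : complexBetti ((E.prod E).prod E).X 3),
          ((IsOfHodgeType Y.dim Y.X 3 2 1 u ∧ IsOfHodgeType ((E.prod E).prod E).dim ((E.prod E).prod E).X 3 1 2 v) ∨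
           (IsOfHodgeType Y.dim Y.X 3 1 2 u ∧ IsOfHodgeType ((E.prod E).prod E).dim ((E.prod E).prod E).X 3 2 1 v)) ∧
          z = cupProduct (show 3 + 3 = 2 * 3 by norm_num)
            (complexBetti.map (Motives.AbelianVariety.fst Y ((E.prod E).prod E)).hom.hom.hom 3 u)
            (complexBetti.map (Motives.AbelianVariety.snd Y ((E.prod E).prod E)).hom.hom.hom 3 v)} := by
  classical
  -- `S = (E × E) × E = E.powSucc 2`
  have hS3 : ((E.prod E).prod E).dim = 3 := by
    rw [Motives.AbelianVariety.dim_prod, Motives.AbelianVariety.dim_prod, hE1]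
  have hXP : IsSmoothProjective (Y.prod ((E.prod E).prod E)).dim (Y.prod ((E.prod E).prod E)).X :=
    AbelianVariety.isSmoothProjective_holds
  have hYs : IsSmoothProjective Y.dim Y.X := AbelianVariety.isSmoothProjective_holds
  have hSs : IsSmoothProjective ((E.prod E).prod E).dim ((E.prod E).prod E).X := AbelianVariety.isSmoothProjective_holds
  have hXE : IsSmoothProjective (Y.prod E).dim (Y.prod E).X := AbelianVariety.isSmoothProjective_holds
  -- the invariance theorem, for `T × S` itself (one slot), `hSc` for `S = E.powSucc 2 = (E × E) × E`
  obtain ⟨hA, bA, h, cC, hbA0, hbA1, hcC0, hcC1, hmain⟩ :=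
    (avSlots_self (Y.prod ((E.prod E).prod E))).exists_coeff_eq_zero_off_balanced_or_unitPair_of_prod_unitaryTwoOne_abelianCommutant
      hY3 hY2 φY hd hφY hm1 (hSc_cmCurve_powSucc hE1 χ hd' hχ 2)
  obtain ⟨a, hca, hsupp⟩ := hmain (by norm_num : 0 < 3) hcQ hc
  have hA3 : hA = 3 := by
    haveI : Module.Finite ℚ (bettiCohomology Y.X 1) := finite_bettiCohomology_one Y
    have hcard := Module.finrank_eq_card_basis bA
    rw [Module.finrank_baseChange, finrank_bettiCohomology_one Y, hY3, Fintype.card_prod, Fintype.card_fin,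
      Fintype.card_fin] at hcard
    omega
  -- the letters, freed of the identity slot
  set xA : (Fin 1 × Fin hA) × Fin 2 → complexBetti Y.X 1 := fun jr =>
    ofRatClassBaseChange (Motives.ComplexPoints Y.X) 1 (bA (jr.1.2, jr.2)) with hxA
  set y : (Fin 1 × Fin h) × Fin 2 → complexBetti ((E.prod E).prod E).X 1 := fun jr =>
    ofRatClassBaseChange (Motives.ComplexPoints ((E.prod E).prod E).X) 1 (cC (jr.1.2, jr.2)) with hy
  set L : (Fin 1 × (Fin hA ⊕ Fin h)) × Fin 2 → complexBetti (Y.prod ((E.prod E).prod E)).X 1 := fun jr => Sum.elim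
    (fun i => complexBetti.map (Motives.AbelianVariety.fst Y ((E.prod E).prod E)).hom.hom.hom 1 (xA ((jr.1.1, i), jr.2)))
    (fun i => complexBetti.map (Motives.AbelianVariety.snd Y ((E.prod E).prod E)).hom.hom.hom 1 (y ((jr.1.1, i), jr.2)))
    jr.1.2 with hL
  have hletters : (fun jr : (Fin 1 × (Fin hA ⊕ Fin h)) × Fin 2 =>
      complexBetti.map ((![𝟙 (Y.prod ((E.prod E).prod E))]) jr.1.1).hom.hom.hom 1
      (Sum.elim
        (fun i => complexBetti.map (Motives.AbelianVariety.fst Y ((E.prod E).prod E)).hom.hom.hom 1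
          (ofRatClassBaseChange (Motives.ComplexPoints Y.X) 1 (bA (i, jr.2))))
        (fun i => complexBetti.map (Motives.AbelianVariety.snd Y ((E.prod E).prod E)).hom.hom.hom 1
          (ofRatClassBaseChange (Motives.ComplexPoints ((E.prod E).prod E).X) 1 (cC (i, jr.2))))
        jr.1.2)) = L := by
    funext jr
    obtain ⟨⟨j, t⟩, r⟩ := jr
    have hj : j = 0 := Subsingleton.elim _ _
    subst hj
    change complexBetti.map (𝟙 (Y.prod ((E.prod E).prod E)).X) 1 _ = _
    rw [complexBetti.map_id]
    rcases t with i | i <;> rfl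
  rw [hletters] at hca
  -- Hodge types of the letters
  have hL0 : ∀ jr : (Fin 1 × (Fin hA ⊕ Fin h)) × Fin 2, jr.2 = 0 →
      IsOfHodgeType (Y.prod ((E.prod E).prod E)).dim (Y.prod ((E.prod E).prod E)).X 1 1 0 (L jr) := by
    rintro ⟨⟨j, t⟩, r⟩ hr
    change r = 0 at hr
    subst hr
    rcases t with i | i
    · exact (hbA0 i).map_of_isSmoothProjective hXP hYs _
    · exact (hcC0 i).map_of_isSmoothProjective hXP hSs _
  have hL1 : ∀ jr : (Fin 1 × (Fin hA ⊕ Fin h)) × Fin 2, jr.2 = 1 →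
      IsOfHodgeType (Y.prod ((E.prod E).prod E)).dim (Y.prod ((E.prod E).prod E)).X 1 0 1 (L jr) := by
    rintro ⟨⟨j, t⟩, r⟩ hr
    change r = 1 at hr
    subst hr
    rcases t with i | i
    · exact (hbA1 i).map_of_isSmoothProjective hXP hYs _
    · exact (hcC1 i).map_of_isSmoothProjective hXP hSs _
  -- `T`-balanced words and the others
  let BAL : (Fin (2 * 3) → (Fin 1 × (Fin hA ⊕ Fin h)) × Fin 2) → Prop := fun w =>
    ∑ t, Sum.elim (fun _ : Fin hA => if (w t).2 = 0 then (1 : ℤ) else -1) (fun _ : Fin h => (0 : ℤ)) (w t).1.2 = 0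
  set aW : (Fin (2 * 3) → (Fin 1 × (Fin hA ⊕ Fin h)) × Fin 2) → ℂ := fun w => if BAL w then 0 else a w with haW
  set aB : (Fin (2 * 3) → (Fin 1 × (Fin hA ⊕ Fin h)) × Fin 2) → ℂ := fun w => if BAL w then a w else 0 with haB
  have hsplit : a = aB + aW := by
    funext w
    simp only [haB, haW, Pi.add_apply]
    split_ifs <;> simp
  set F := cupPowOneAlt ℂ (Motives.ComplexPoints (Y.prod ((E.prod E).prod E)).X) (2 * 3) with hF
  set cW := wordEval F L aW with hcW
  set cB := wordEval F L aB with hcB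
  have hc_eq : c = cB + cW := by rw [← hca, hsplit, map_add]
  -- the unbalanced words in the support: kind balanced, no repeated letter, exactly `3` `T`-positions
  have hsuppW : ∀ w : Fin (2 * 3) → (Fin 1 × (Fin hA ⊕ Fin h)) × Fin 2, ¬ BAL w → a w ≠ 0 →
      (∀ r : Fin 2, (Finset.univ.filter fun t => (w t).2 = r).card = 3) ∧
        Function.Injective (fun t => ((w t).1.2, (w t).2)) ∧
        Fintype.card {t // ((w t).1.2).isLeft = true} = 3 ∧
        ((∑ t, Sum.elim (fun _ : Fin hA => if (w t).2 = 0 then (1 : ℤ) else -1) (fun _ : Fin h => (0 : ℤ)) (w t).1.2 = 1) ∨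
         (∑ t, Sum.elim (fun _ : Fin hA => if (w t).2 = 0 then (1 : ℤ) else -1) (fun _ : Fin h => (0 : ℤ)) (w t).1.2 = -1)) := by
    intro w hw hne
    obtain ⟨hcnt, hinj, hbal | ⟨hcard, hunit⟩⟩ := hsupp (fun t => (w t).1) (fun t => (w t).2) (by simpa using hne)
    · exact absurd hbal hw
    · exact ⟨hcnt, hinj, by rw [hcard, hA3], hunit⟩
  -- (1) `c_W` is of type `(2,2)` (kind balance), hence so is `c_B = c - c_W`
  have hmono33 : ∀ w : Fin (2 * 3) → (Fin 1 × (Fin hA ⊕ Fin h)) × Fin 2, ¬ BAL w → a w ≠ 0 →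
      IsOfHodgeType (Y.prod ((E.prod E).prod E)).dim (Y.prod ((E.prod E).prod E)).X (2 * 3) 3 3 (F (L ∘ w)) := by
    intro w hw hne
    obtain ⟨hcnt, -, -, -⟩ := hsuppW w hw hne
    have h22 := isOfHodgeType_cupPowOne_of_kinds L hL0 hL1 w
    have e0 : (∑ t, if (w t).2 = 0 then 1 else 0 : ℕ) = 3 := by
      rw [← Finset.card_filter]; exact hcnt 0
    have e1 : (∑ t, if (w t).2 = 0 then 0 else 1 : ℕ) = 3 := by
      have h' : ∀ t, (if (w t).2 = 0 then 0 else 1 : ℕ) = if (w t).2 = 1 then 1 else 0 := fun t => by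
        rcases fin2_eq_zero_or_one_c3 (w t).2 with h0 | h0 <;> simp [h0]
      simp only [h']
      rw [← Finset.card_filter]; exact hcnt 1
    rw [e0, e1] at h22
    rw [hF, cupPowOneAlt_apply]
    exact h22
  have hcW33 : IsOfHodgeType (Y.prod ((E.prod E).prod E)).dim (Y.prod ((E.prod E).prod E)).X (2 * 3) 3 3 cW := by
    rw [hcW, wordEval_apply]
    refine IsOfHodgeType.sum hXP (nonempty_hodgeModel_holds hXP).some _ _ fun w _ => ?_
    by_cases hw : BAL w
    · simp only [haW, if_pos hw, zero_smul]
      exact IsOfHodgeType.zero (nonempty_hodgeModel_holds hXP).some _ _ _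
    · by_cases hne : a w = 0
      · simp only [haW, if_neg hw, hne, zero_smul]
        exact IsOfHodgeType.zero (nonempty_hodgeModel_holds hXP).some _ _ _
      · simp only [haW, if_neg hw]
        exact (hmono33 w hw hne).smul _
  have hcB33 : IsOfHodgeType (Y.prod ((E.prod E).prod E)).dim (Y.prod ((E.prod E).prod E)).X (2 * 3) 3 3 cB := by
    have e : cB = c - cW := by rw [hc_eq, add_sub_cancel_right]
    rw [e]; exact hc.sub hXP hcW33
  -- Hodge types of the freed letters
  have hxA0 : ∀ jr : (Fin 1 × Fin hA) × Fin 2, jr.2 = 0 → IsOfHodgeType Y.dim Y.X 1 1 0 (xA jr) :=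
    fun jr hjr => by obtain ⟨⟨j, i⟩, r⟩ := jr; change r = 0 at hjr; subst hjr; exact hbA0 i
  have hxA1 : ∀ jr : (Fin 1 × Fin hA) × Fin 2, jr.2 = 1 → IsOfHodgeType Y.dim Y.X 1 0 1 (xA jr) :=
    fun jr hjr => by obtain ⟨⟨j, i⟩, r⟩ := jr; change r = 1 at hjr; subst hjr; exact hbA1 i
  have hy0 : ∀ jr : (Fin 1 × Fin h) × Fin 2, jr.2 = 0 →
      IsOfHodgeType ((E.prod E).prod E).dim ((E.prod E).prod E).X 1 1 0 (y jr) :=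
    fun jr hjr => by obtain ⟨⟨j, i⟩, r⟩ := jr; change r = 0 at hjr; subst hjr; exact hcC0 i
  have hy1 : ∀ jr : (Fin 1 × Fin h) × Fin 2, jr.2 = 1 →
      IsOfHodgeType ((E.prod E).prod E).dim ((E.prod E).prod E).X 1 0 1 (y jr) :=
    fun jr hjr => by obtain ⟨⟨j, i⟩, r⟩ := jr; change r = 1 at hjr; subst hjr; exact hcC1 i
  -- (2) `c_B` lies in the span of the typed products
  have hcB_mem := wordEval_mem_span_typed_cup_pureType_of_eq_zero_off_balanced
    (Motives.AbelianVariety.fst Y ((E.prod E).prod E)) (Motives.AbelianVariety.snd Y ((E.prod E).prod E)) xA y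
    hxA0 hxA1 hy0 hy1 (p := 3) (a := aB) (fun U η hU => by
      by_cases hw : BAL (fun t => (U t, η t))
      · exfalso
        apply hU
        have hcast : ∀ t, Sum.elim (fun _ : Fin hA => if η t = 0 then (1 : ℂ) else -1) (fun _ : Fin h => (0 : ℂ))
            (U t).2 = ((Sum.elim (fun _ : Fin hA => if η t = 0 then (1 : ℤ) else -1) (fun _ : Fin h => (0 : ℤ))
              (U t).2 : ℤ) : ℂ) := by
          intro t
          rcases (U t).2 with ℓ | e
          · simp only [Sum.elim_inl]; split_ifs <;> simp
          · simp
        have hw' : ∑ t, Sum.elim (fun _ : Fin hA => if η t = 0 then (1 : ℤ) else -1) (fun _ : Fin h => (0 : ℤ))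
            (U t).2 = 0 := hw
        simp only [hcast]
        rw [← Int.cast_sum, hw', Int.cast_zero]
      · simp only [haB, if_neg hw])
  -- (3) RATIONALITY of `c_W`: it is the Künneth component of `c` of `S`-degree `1`
  have hb : ∀ j : Fin (2 * ((E.prod E).prod E).dim + 1), ∃ (r : ℕ) (b : Module.Basis (Fin r) ℂ (complexBetti ((E.prod E).prod E).X j)),
      ∀ i, IsRationalClass (b i) := fun j => exists_basis_isRationalClass hSs j
  choose r b hbQ using hb
  have hbij : Function.Bijective (LerayHirsch.lhMap ℂ (fun J : (Σ j, Fin (r j)) => (J.1 : ℕ))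
      (Motives.AlgPoints.mapContinuous (L := ℂ) (Motives.AbelianVariety.fst Y ((E.prod E).prod E)).hom.hom.hom)
      (fun J => complexBetti.map (Motives.AbelianVariety.snd Y ((E.prod E).prod E)).hom.hom.hom J.1 (b J.1 J.2)) (2 * 3)) :=
    complexBetti_kunneth_bijective hYs hSs b (2 * 3)
  set θ := LinearEquiv.ofBijective _ hbij with hθ
  have hθsum : ∀ a' : (Fin (2 * 3) → (Fin 1 × (Fin hA ⊕ Fin h)) × Fin 2) → ℂ,
      θ.symm (∑ w, a' w • F (L ∘ w)) = ∑ w, θ.symm (a' w • F (L ∘ w)) := fun a' => map_sum θ.symm _ _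
  have hθsmul : ∀ (s : ℂ) (x : complexBetti (Y.prod ((E.prod E).prod E)).X (2 * 3)), θ.symm (s • x) = s • θ.symm x :=
    fun s x => map_smul θ.symm s x
  have hθadd : ∀ x x' : complexBetti (Y.prod ((E.prod E).prod E)).X (2 * 3), θ.symm (x + x') = θ.symm x + θ.symm x' :=
    fun x x' => map_add θ.symm x x'
  -- Künneth coefficients of `pr_T^* u ⌣ pr_S^* v` vanish off the `S`-degree of `v`
  have hvan : ∀ (m r' : ℕ) (hmr : m + r' = 2 * 3) (u : complexBetti Y.X m) (v : complexBetti ((E.prod E).prod E).X r')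
      (J : LerayHirsch.Idx (fun J : (Σ j, Fin (r j)) => (J.1 : ℕ)) (2 * 3)), (J.1.1 : ℕ) ≠ r' →
      θ.symm (cupProduct hmr (complexBetti.map (Motives.AbelianVariety.fst Y ((E.prod E).prod E)).hom.hom.hom m u)
        (complexBetti.map (Motives.AbelianVariety.snd Y ((E.prod E).prod E)).hom.hom.hom r' v)) J = 0 := by
    intro m r' hmr u v J hJ
    by_cases hr2 : r' ≤ 2 * ((E.prod E).prod E).dim
    · obtain rfl : m = 2 * 3 - r' := by omega
      have key : θ.symm (cupProduct hmr (complexBetti.map (Motives.AbelianVariety.fst Y ((E.prod E).prod E)).hom.hom.hom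
          (2 * 3 - r') u) (complexBetti.map (Motives.AbelianVariety.snd Y ((E.prod E).prod E)).hom.hom.hom r' v)) = _ :=
        kunneth_symm_cupProduct_eq_sum hYs hSs b (2 * 3) (j := ⟨r', by omega⟩) (by change r' ≤ 2 * 3; omega) u v
      rw [key, Finset.sum_apply]
      refine Finset.sum_eq_zero fun i _ => ?_
      rw [Pi.smul_apply, Pi.single_eq_of_ne, smul_zero]
      intro hJi
      apply hJ
      rw [hJi]
    · haveI := subsingleton_complexBetti hSs (lt_of_not_ge hr2)
      have hv : v = 0 := Subsingleton.elim _ _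
      rw [hv, map_zero, map_zero]
      exact congrFun (map_zero θ.symm) J
  -- every word's monomial is `± pr_T^*(T-monomial) ⌣ pr_S^*(S-monomial)`, the `S`-degree being the number of
  -- `S`-positions
  have hterm : ∀ w : Fin (2 * 3) → (Fin 1 × (Fin hA ⊕ Fin h)) × Fin 2,
      ∃ (m r' : ℕ) (hmr : m + r' = 2 * 3) (u : complexBetti Y.X m) (v : complexBetti ((E.prod E).prod E).X r') (s : ℂ)
        (n₀ n₁ k₀ k₁ : ℕ),
        F (L ∘ w) = s • cupProduct hmr (complexBetti.map (Motives.AbelianVariety.fst Y ((E.prod E).prod E)).hom.hom.hom m u)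
          (complexBetti.map (Motives.AbelianVariety.snd Y ((E.prod E).prod E)).hom.hom.hom r' v) ∧
        m = Fintype.card {t // ((w t).1.2).isLeft = true} ∧ r' = Fintype.card {t // ¬ ((w t).1.2).isLeft = true} ∧
        IsOfHodgeType Y.dim Y.X m n₀ n₁ u ∧ IsOfHodgeType ((E.prod E).prod E).dim ((E.prod E).prod E).X r' k₀ k₁ v ∧
        n₀ + n₁ = m ∧ k₀ + k₁ = r' ∧ n₀ + k₀ = (∑ t, if (w t).2 = 0 then 1 else 0 : ℕ) ∧
        ((n₀ : ℤ) - n₁ = ∑ t, Sum.elim (fun _ : Fin hA => if (w t).2 = 0 then (1 : ℤ) else -1) (fun _ : Fin h => (0 : ℤ))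
          (w t).1.2) := by
    intro w
    set col : Fin (2 * 3) → Fin hA ⊕ Fin h := fun t => (w t).1.2 with hcol
    set m := Fintype.card {t // (col t).isLeft = true} with hm
    set r' := Fintype.card {t // ¬ (col t).isLeft = true} with hr'
    have hmr : m + r' = 2 * 3 := card_isLeft_add_card_not_isLeft_c3 col
    obtain ⟨φ, τA, iC, hAcol, hCcol⟩ := exists_leftSplit col hm.symm hr'.symm
    set wA : Fin m → (Fin 1 × Fin hA) × Fin 2 := fun a' =>
      (((w (φ.symm (Sum.inl a'))).1.1, τA a'), (w (φ.symm (Sum.inl a'))).2) with hwA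
    set wC : Fin r' → (Fin 1 × Fin h) × Fin 2 := fun b' =>
      (((w (φ.symm (Sum.inr b'))).1.1, iC b'), (w (φ.symm (Sum.inr b'))).2) with hwC
    have hword : (L ∘ w) = fun t => Sum.elim
        (fun a' => complexBetti.map (Motives.AbelianVariety.fst Y ((E.prod E).prod E)).hom.hom.hom 1 (xA (wA a')))
        (fun b' => complexBetti.map (Motives.AbelianVariety.snd Y ((E.prod E).prod E)).hom.hom.hom 1 (y (wC b'))) (φ t) := by
      funext t
      obtain ⟨s, rfl⟩ := φ.symm.surjective t
      rw [Function.comp_apply, Equiv.apply_symm_apply]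
      rcases s with a' | b'
      · have h1 : (w (φ.symm (Sum.inl a'))).1.2 = Sum.inl (τA a') := hAcol a'
        simp only [hL, h1, Sum.elim_inl, hwA]
      · have h1 : (w (φ.symm (Sum.inr b'))).1.2 = Sum.inr (iC b') := hCcol b'
        simp only [hL, h1, Sum.elim_inr, hwC]
    -- kind counts of the two parts
    have hsplit0 : (∑ t, if (w t).2 = 0 then 1 else 0 : ℕ) =
        (∑ a', if (wA a').2 = 0 then 1 else 0 : ℕ) + ∑ b', if (wC b').2 = 0 then 1 else 0 := by
      rw [← φ.symm.sum_comp, Fintype.sum_sum_type]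
    have hweight : ∑ t, Sum.elim (fun _ : Fin hA => if (w t).2 = 0 then (1 : ℤ) else -1) (fun _ : Fin h => (0 : ℤ))
        (w t).1.2 = ∑ a', (if (wA a').2 = 0 then (1 : ℤ) else -1) := by
      rw [← φ.symm.sum_comp, Fintype.sum_sum_type]
      have hC0 : ∑ b', Sum.elim (fun _ : Fin hA => if (w (φ.symm (Sum.inr b'))).2 = 0 then (1 : ℤ) else -1)
          (fun _ : Fin h => (0 : ℤ)) (w (φ.symm (Sum.inr b'))).1.2 = 0 := by
        refine Finset.sum_eq_zero fun b' _ => ?_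
        have h1 : (w (φ.symm (Sum.inr b'))).1.2 = Sum.inr (iC b') := hCcol b'
        rw [h1, Sum.elim_inr]
      rw [hC0, add_zero]
      refine Finset.sum_congr rfl fun a' _ => ?_
      have h1 : (w (φ.symm (Sum.inl a'))).1.2 = Sum.inl (τA a') := hAcol a'
      rw [h1, Sum.elim_inl]
    refine ⟨m, r', hmr, cupPowOne ℂ (Motives.ComplexPoints Y.X) m (xA ∘ wA),
      cupPowOne ℂ (Motives.ComplexPoints ((E.prod E).prod E).X) r' (y ∘ wC),
      (((Equiv.Perm.sign (φ.trans (finSumFinEquiv.trans (finCongr hmr))) : ℤˣ) : ℤ) : ℂ),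
      (∑ a', if (wA a').2 = 0 then 1 else 0 : ℕ), (∑ a', if (wA a').2 = 0 then 0 else 1 : ℕ),
      (∑ b', if (wC b').2 = 0 then 1 else 0 : ℕ), (∑ b', if (wC b').2 = 0 then 0 else 1 : ℕ),
      ?_, rfl, rfl, isOfHodgeType_cupPowOne_of_kinds xA hxA0 hxA1 wA, isOfHodgeType_cupPowOne_of_kinds y hy0 hy1 wC,
      sum_kinds_add_c3 wA, sum_kinds_add_c3 wC, hsplit0.symm, ?_⟩
    · rw [hF, cupPowOneAlt_apply, hword, cupPowOne_sumElim_eq_sign_smul_cupProduct ℂ φ hmr,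
        ← Motives.complexBetti_map_cupPowOne, ← Motives.complexBetti_map_cupPowOne]
      rfl
    · rw [hweight]; exact kinds_sub_eq_weight_c3 wA
  -- `S`-degrees: unbalanced words `3`, balanced words even (`≠ 3`)
  have hdegW : ∀ w : Fin (2 * 3) → (Fin 1 × (Fin hA ⊕ Fin h)) × Fin 2, ¬ BAL w → a w ≠ 0 →
      Fintype.card {t // ¬ ((w t).1.2).isLeft = true} = 3 := by
    intro w hw hne
    obtain ⟨-, -, h3, -⟩ := hsuppW w hw hne
    have hsum := card_isLeft_add_card_not_isLeft_c3 (fun t => (w t).1.2)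
    omega
  have hdegB : ∀ w : Fin (2 * 3) → (Fin 1 × (Fin hA ⊕ Fin h)) × Fin 2, BAL w → a w ≠ 0 →
      Fintype.card {t // ¬ ((w t).1.2).isLeft = true} ≠ 3 := by
    intro w hw _
    have hw' : ∑ t, Sum.elim (fun _ : Fin hA => if (w t).2 = 0 then (1 : ℤ) else -1) (fun _ : Fin h => (0 : ℤ))
        (w t).1.2 = 0 := hw
    have hev := even_card_isLeft_of_balanced_c3 (fun t => (w t).1.2) (fun t => (w t).2) hw'
    have hmr := card_isLeft_add_card_not_isLeft_c3 (fun t => (w t).1.2)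
    obtain ⟨k, hk⟩ := hev
    omega
  -- Künneth coefficients: `c_W` has only `S`-degree-`1` coefficients, `c_B` none
  have hθW : ∀ J : LerayHirsch.Idx (fun J : (Σ j, Fin (r j)) => (J.1 : ℕ)) (2 * 3), (J.1.1 : ℕ) ≠ 3 →
      θ.symm cW J = 0 := by
    intro J hJ
    rw [hcW, wordEval_apply, hθsum, Finset.sum_apply]
    refine Finset.sum_eq_zero fun w _ => ?_
    rw [hθsmul, Pi.smul_apply]
    by_cases hw : BAL w
    · simp only [haW, if_pos hw, zero_smul]
    · by_cases hne : a w = 0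
      · simp only [haW, if_neg hw, hne, zero_smul]
      · obtain ⟨m, r', hmr, u, v, s, -, -, -, -, hFw, -, hr', -⟩ := hterm w
        have h1 : r' = 3 := by rw [hr']; exact hdegW w hw hne
        rw [hFw, hθsmul, Pi.smul_apply, hvan m r' hmr u v J (by rw [h1]; exact hJ), smul_zero, smul_zero]
  have hθB : ∀ J : LerayHirsch.Idx (fun J : (Σ j, Fin (r j)) => (J.1 : ℕ)) (2 * 3), (J.1.1 : ℕ) = 3 →
      θ.symm cB J = 0 := by
    intro J hJ
    rw [hcB, wordEval_apply, hθsum, Finset.sum_apply]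
    refine Finset.sum_eq_zero fun w _ => ?_
    rw [hθsmul, Pi.smul_apply]
    by_cases hw : BAL w
    · by_cases hne : a w = 0
      · simp only [haB, if_pos hw, hne, zero_smul]
      · obtain ⟨m, r', hmr, u, v, s, -, -, -, -, hFw, -, hr', -⟩ := hterm w
        have h1 : r' ≠ 3 := by rw [hr']; exact hdegB w hw hne
        rw [hFw, hθsmul, Pi.smul_apply, hvan m r' hmr u v J (by rw [hJ]; exact Ne.symm h1), smul_zero, smul_zero]
    · simp only [haB, if_neg hw, zero_smul]
  -- `θ⁻¹ c_W` is the `S`-degree-`1` truncation of `θ⁻¹ c`, whose entries are rational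
  set a₁ : LerayHirsch.Src ℂ (fun J : (Σ j, Fin (r j)) => (J.1 : ℕ)) (Motives.ComplexPoints Y.X) (2 * 3) :=
    fun J => if (J.1.1 : ℕ) = 3 then θ.symm c J else 0 with ha₁
  have hθcW : θ.symm cW = a₁ := by
    funext J
    by_cases hJ : (J.1.1 : ℕ) = 3
    · rw [ha₁]; simp only [if_pos hJ]
      rw [hc_eq, hθadd, Pi.add_apply, hθB J hJ, zero_add]
    · rw [ha₁]; simp only [if_neg hJ]
      exact hθW J hJ
  have hcW_eq : cW = θ a₁ := by rw [← hθcW, LinearEquiv.apply_symm_apply]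
  have hcWQ : IsRationalClass cW := by
    rw [hcW_eq, hθ, LinearEquiv.ofBijective_apply, LerayHirsch.lhMap_apply]
    refine isRationalClass_sum _ _ fun J _ => ?_
    split_ifs with hJk
    · refine (IsRationalClass.map _ ?_).cup _ ((hbQ J.1 J.2).map _)
      rw [ha₁]
      dsimp only
      split_ifs with hJ1
      · exact isRationalClass_kunneth_symm_apply hYs hSs b hbQ (2 * 3) hcQ ⟨J, hJk⟩
      · exact IsRationalClass.zero
    · exact IsRationalClass.zero
  have hcBQ : IsRationalClass cB := by
    have e : cB = c - cW := by rw [hc_eq, add_sub_cancel_right]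
    rw [e]; exact hcQ.sub hcWQ
  -- (4) `c_W` lies in the span of the typed exterior products `pr_T^* u ⌣ pr_S^* v`, `(u,v)` of types `((2,1),(1,2))`
  -- or `((1,2),(2,1))`: one letter per `T`-pair (`T`-degree `3`), `T`-kind weight `±1`, total type `(3,3)`
  have hspanW : cW ∈ Submodule.span ℂ {z : complexBetti (Y.prod ((E.prod E).prod E)).X (2 * 3) |
      ∃ (u : complexBetti Y.X 3) (v : complexBetti ((E.prod E).prod E).X 3),
        ((IsOfHodgeType Y.dim Y.X 3 2 1 u ∧ IsOfHodgeType ((E.prod E).prod E).dim ((E.prod E).prod E).X 3 1 2 v) ∨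
         (IsOfHodgeType Y.dim Y.X 3 1 2 u ∧ IsOfHodgeType ((E.prod E).prod E).dim ((E.prod E).prod E).X 3 2 1 v)) ∧
        z = cupProduct (show 3 + 3 = 2 * 3 by norm_num)
          (complexBetti.map (Motives.AbelianVariety.fst Y ((E.prod E).prod E)).hom.hom.hom 3 u)
          (complexBetti.map (Motives.AbelianVariety.snd Y ((E.prod E).prod E)).hom.hom.hom 3 v)} := by
    rw [hcW, wordEval_apply]
    refine Submodule.sum_mem _ fun w _ => ?_
    by_cases hw : BAL w
    · simp only [haW, if_pos hw, zero_smul]; exact Submodule.zero_mem _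
    · by_cases hne : a w = 0
      · simp only [haW, if_neg hw, hne, zero_smul]; exact Submodule.zero_mem _
      · simp only [haW, if_neg hw]
        refine Submodule.smul_mem _ _ ?_
        obtain ⟨hcnt, -, hT3, hunit⟩ := hsuppW w hw hne
        obtain ⟨m, r', hmr, u, v, s, n₀, n₁, k₀, k₁, hFw, hm, hr', hu, hv, hnm, hkr, hnk, hwt⟩ := hterm w
        have hm3 : m = 3 := by rw [hm, hT3]
        have hr3 : r' = 3 := by
          have hsum := card_isLeft_add_card_not_isLeft_c3 (fun t => (w t).1.2)
          omega
        subst hm3 hr3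
        have e0 : (∑ t, if (w t).2 = 0 then 1 else 0 : ℕ) = 3 := by
          rw [← Finset.card_filter]; exact hcnt 0
        rw [e0] at hnk
        rw [hFw]
        refine Submodule.smul_mem _ _ (Submodule.subset_span ⟨u, v, ?_, rfl⟩)
        rcases hunit with h1 | h1
        · rw [h1] at hwt
          have hn₀ : n₀ = 2 := by omega
          have hn₁ : n₁ = 1 := by omega
          have hk₀ : k₀ = 1 := by omega
          have hk₁ : k₁ = 2 := by omega
          subst hn₀ hn₁ hk₀ hk₁
          exact Or.inl ⟨hu, hv⟩
        · rw [h1] at hwt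
          have hn₀ : n₀ = 1 := by omega
          have hn₁ : n₁ = 2 := by omega
          have hk₀ : k₀ = 2 := by omega
          have hk₁ : k₁ = 1 := by omega
          subst hn₀ hn₁ hk₀ hk₁
          exact Or.inr ⟨hu, hv⟩
  -- (5) `c_B ∈ D³`: products of rational Hodge classes of `T` and of `S`, divisor classes in dimensions `≤ 3`
  have hcBD : cB ∈ divisorClassesSpan (Y.prod ((E.prod E).prod E)).X (Y.prod ((E.prod E).prod E)).dim 3 := by
    have hcB33' : IsOfHodgeType (Y.dim + ((E.prod E).prod E).dim) (Y.X ⊗ ((E.prod E).prod E).X) (2 * 3) 3 3 cB := by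
      rw [← Motives.AbelianVariety.dim_prod]; exact hcB33
    have hspan := mem_span_hodgeProductClasses_of_mem_span_pureType Y ((E.prod E).prod E) hcBQ hcB33'
      (Submodule.span_mono ?_ hcB_mem)
    swap
    · rintro z ⟨i, j, hij, dd, μ, hdd, hμ, rfl⟩
      exact ⟨i, j, hij, dd, μ, hdd, hμ, rfl⟩
    rw [Motives.AbelianVariety.dim_prod]
    exact Submodule.span_le.2 (hodgeProductClasses_subset_divisorClassesSpan Y ((E.prod E).prod E)
      (isDivisorGenerated_of_dim_le_three Y (by omega)) (isDivisorGenerated_of_dim_le_three ((E.prod E).prod E) (by omega)) 3)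
      hspan
  exact ⟨cB, cW, hc_eq, hcBD, hcWQ, hcW33, hspanW⟩

end CodimThree

end Literature.AlgebraicGeometry.HodgeTheory

end
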